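import Summits.Schanuel.Schanuel.Theorems.RootDecomp1KSiegelFunctions02

/-!
# RootDecomp1KSiegelFunctions — lens 1, generation 71, NODE 31 «THE HEIGHT BINDER HALVED: `HeightComparison ⟸ SiegelFunctionsAll`, ARITHMETIC HALF PROVED» (×0-AS-RECORD + one contingent ×1 at FLOOR G (a) — PRICE 31 L3149, RULING L3160, NODE L3172, VERDICT L3175): the node-12 hypothesis binder `HeightComparison` (Weil–Siegel height comparison on a plane curve) is, definitionally, `∀ P, GeomIrreducible P → 1 ≤ xdeg P → 1 ≤ deg_Y P → HeightComparisonAt P`, and `heightComparisonAt_of_siegelFunctions` PROVES `HeightComparisonAt P` from the GEOMETRIC datum `SiegelFunctions P ∧ SiegelFunctions (swap P)` (two integral functions of controlled degree for every b ≥ 1); the ARITHMETIC half (rational-root integrality, archimedean root bound, `h(y^b) = b·h(y)`, finite exceptional fibres by Bezout, exchange of variables) is proved sorry-free; hence `heightComparison_of_siegelFunctionsAll : SiegelFunctionsAll → HeightComparison` and the node-12 heads re-pointed BY NAME; the geometric half `SiegelFunctionsAll` is a typed HYPOTHESIS (plan S1–S6 in the docstring of `SiegelFunctions`), NOT proved;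 (G)-instances by hand: `parabP` / its transpose / `hyperbP`, and the infinite family 𝒞₃ = {(x·Y − 1)² − f(x) : f cubic, f(0) ≠ 1} in BOTH charts (Lucas trace; the 3 × 3 POWER LEMMA), its geometric irreducibility, and the HYPOTHESIS-FREE `heightComparisonAt_sqLinP` / `thinFibreAt_two_sqLinP` — ×0-AS-RECORD toolkit per RULING L3160 (every 𝒞₃ member is also decided by the numerator lever); `PadicSubspace`, items 33364 / 33363 / 31077 / 31987 and the tally UNMOVED — continuation (RootDecomp1KSiegelFunctions03): §3  Heights: `H(y^b) = H(y)^b`, `H(U/V) ≤ max(|U|,|V|)`, and LEMMA H (two relations ⇒ `b·h(y) ≤ a·h(x) + C`) · §4  On the curve: the relations at a rational point, the finite exceptional set, the ONE-SIDED comparison — 9 declarations `HtQ_pow` … `upperComparisonAt_of_siegelFunctions`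

(lens-1 g71 NODE 31 «THE HEIGHT BINDER HALVED» L3172: HOME kernel K = HOME/decomp-schanuel-lens-1/g71/lean/SiegelFunctions.lean sha256 4f39c136…, 1983 l, 207 decls (173 theorems + 34 defs by the critic's count, VERDICT L3175; NODE's «208» an e-lite), ONE namespace `Summit.Schanuel.Schanuel.Theorems.RootDecomp1KSiegelFunctions` (inner anonymous-free sections `PowerLemma` / `Chart2` / `GeomIrreducible` with their `variable`s kept whole inside one part each), imports EXACTLY the tree port …RootDecomp1KHeightGrading02 (node 12: `HeightComparison`, `HeightDecidedAt`, `GeomIrreducible`, `logHt` BY TREE NAME) + `Literature.NumberTheory.DiophantineGeometry.PlaneCurveBezoutWeak` + `Mathlib.RingTheory.Polynomial.RationalRoot`; no private / instance / set_option / notation / sorry / new axiom / native_decide / [cite; lens farm rc 0 · 0 errors · 0 sorries · dupNamespace warnings only; `#print axioms` = [propext, Classical.choice, Quot.sound] on the nine probed heads (g71/out/ax_*.json), Probe g71/out/ProbeK.lean 2659bdec… rc 0 (rfl pin `HeightComparison` = tree), CONTROLS A / A0 / B rc 1 as designed (ctrlA 4ae3a6d6… / ctrlA0 ff875685… / ctrlB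 f20add70…), memo g71/NODE-g71.md 07fb49f8…, SHA256SUMS 34 files; CLAIM 31 L3146; crit PRICE 31 L3149 (×0-as-record + one contingent ×1 at FLOOR G; CHECKLIST K-g71; RULES K-R59 / K-R60 pre-announced); lens ASK-FIRST FAMILY CLAIM L3158 (𝒞₃) and crit RULING L3160 (𝒞₃ REFUSED as a FLOOR-G (b) family: numerator lever, NUMEXP; toolkit ×0 under K-R60 (i)); census INSTRUMENT NOTES 54–56 L3161 / L3163 / L3167 (LIVENESS-v46 / v47 / v48: rows 75–77 = 𝒞₃ members, keys numexp / numexp_tight / k60) and crit ACKs L3165 / L3168; writer NOTES 4 / 5 L3162 / L3173; crit-1 (g13) VERDICT 31 L3175: «NODE 31 = ×0-AS-RECORD BOOKED; CHECKLIST K-g71 (J1)–(J7) MET; the contingent THEOREM ×1 REGISTERED under K-R59 (ii), UNPAID (FLOOR G unmet); RULES K-R59 and K-R60 (i)–(iv) FIXED; PORT GO» — kernel re-verified by the critic (farm rc 0 · 0 errors · 0 sorries; 207 decls = 173 theorems + 34 defs; axioms standard re-probed on 27 heads), record: piece C227 «HeightComparison ⟸ SiegelFunctionsAll», the K-line binder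 HeightComparison henceforth CONSUMED through heightComparison_of_siegelFunctionsAll (Dom re-pointing BY NAME, antecedent count unchanged), 𝒞₃ / InC3 decided hypothesis-free by thinFibreAt_of_inC3 / thinFibreAt_two_sqLinP = the K-R60 (i) kernel shape (TOOLKIT, ×0, never payable), tally UNCHANGED lens-1 ×22 + THEOREM ×24, EXHIBITS ρ1 / ρ2 VACANT, 33364 / 33363 / 31077 / 31987 OPEN rung 0. Port by census-1 gen 26 as `RootDecomp1KSiegelFunctions01–09` (files ≤ 400 lines; chain 01 ← the three K imports, 0k ← 0(k−1); `--supports stmt-Schanuel-33364`, the item stays OPEN; ×0 record port — the geometric binder `SiegelFunctions` / `SiegelFunctionsAll` appears ONLY as an explicit hypothesis of the `…_of_siegelFunctions…` heads, never an axiom / instance / variable; no credit anywhere; the section-aligned 9-part split is lens-1's port plan (J7) re-built by the census pipeline): 01 = K-port l.1–216 (§0 / §1) — 25 decls `ratModel`, `QDvd`, `relPoly`, …, `evalEval_ratModel_relPoly`; 02 = K-port l.219–450 (§2) — 20 decls `scaledEval`, `l1`, `l1_nonneg`, …, `abs_le_of_rel`; 03 = K-port l.453–658 (§3 / §4) — 9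 decls `HtQ_pow`, `logHt_pow`, `HtQ_intDiv_le`, …, `upperComparisonAt_of_siegelFunctions`; 04 = K-port l.661–830 (§5) — 13 decls `coeff_coeff_swap`, `map_swap`, `natDegree_swap`, …, `heightComparison_of_siegelFunctions`; 05 = K-port l.833–1105 (§6 / §7) — 28 decls `thinFibreAt_of_heightComparisonAt`, `thinFibreAt_of_heightComparison'`, `thinFibreAt_of_siegelFunctions`, …, `siegelFunctions_toys`; 06 = K-port l.1107–1300 (§8) — 20 decls `sqLinP`, `sqLinP_eq`, `natDegree_sqLinP`, …, `thinFibreAt_sqLinP_of_swap`; 07 = K-port l.1302–1547 (§9) — 35 decls `compM`, `cubic`, `cubic_eq`, …, `natDegree_det3_compM_pow_le`; 08 = K-port l.1549–1856 (§10) — 40 decls `q₃`, `q₂`, `q₁`, …, `heightComparisonAt_sqLinP_of_geomIrreducible`; 09 = K-port l.1858–2074 (§11 / §12) — 17 decls `sqLinK`, `coeff_sqLinK`, `natDegree_sqLinK`, …, `thinFibreAt_of_inC3`. 91 one-line docstrings synthesised for undocumented helper declarations (statements quoted); ONE port-side modifier of record: `sum_Icc_half_pow` (§2, part 02) is `private`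 with a PORT NOTE after the `dedup.landed` bounce p850627 (≡ `Literature.Computability.Cryptography.HashDom.sum_Icc_half_pow`); everything else = K VERBATIM (statements, names, proofs, K's module docstring kept in part 01 below this provenance block).)
-/

noncomputable section

namespace Summit.Schanuel.Schanuel.Theorems.RootDecomp1KSiegelFunctions

open Polynomial
open scoped Nat
open Summit.Schanuel.Schanuel.Theorems.RootDecomp1KDegreeLadder (bev xdeg natDegree_coeff_le_xdeg ThinFibreAt ThinFibre
  thinFibreAt_of_natDegree_lt)
open Summit.Schanuel.Schanuel.Theorems.RootDecomp1KHeightGrading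

/-! ### §3  Heights: `H(y^b) = H(y)^b`, `H(U/V) ≤ max(|U|,|V|)`, and LEMMA H (two relations ⇒ `b·h(y) ≤ a·h(x) + C`) -/

/-- `H(y^b) = H(y)^b` (`num (y^b) = (num y)^b`, `den (y^b) = (den y)^b`). -/
theorem HtQ_pow (y : ℚ) (b : ℕ) : HtQ (y ^ b) = HtQ y ^ b := by
  unfold HtQ
  rw [Rat.num_pow, Rat.den_pow]
  push_cast
  rw [abs_pow]
  have hA : (0 : ℝ) ≤ |(y.num : ℝ)| := abs_nonneg _
  have hB : (0 : ℝ) ≤ (y.den : ℝ) := by positivity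
  rcases le_total |(y.num : ℝ)| (y.den : ℝ) with h | h
  · rw [max_eq_right h, max_eq_right (pow_le_pow_left₀ hA h b)]
  · rw [max_eq_left h, max_eq_left (pow_le_pow_left₀ hB h b)]

/-- `h(y^b) = b·h(y)`. -/
theorem logHt_pow (y : ℚ) (b : ℕ) : logHt (y ^ b) = b * logHt y := by
  rw [logHt_eq_log_HtQ, logHt_eq_log_HtQ, HtQ_pow, Real.log_pow]

/-- `H(U/V) ≤ max(|U|,|V|)` for integers `U`, `V ≠ 0` (`num ∣ U`, `den ∣ V`). -/
theorem HtQ_intDiv_le (U V : ℤ) (hV : V ≠ 0) : HtQ ((U : ℚ) / V) ≤ max |(U : ℝ)| |(V : ℝ)| := by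
  unfold HtQ
  rw [Rat.intCast_div_eq_divInt]
  refine max_le_max ?_ ?_
  · have hdvd : (Rat.divInt U V).num ∣ U := Rat.num_dvd U hV
    rcases eq_or_ne U 0 with hU | hU
    · subst hU; simp
    · have h := Nat.le_of_dvd (Int.natAbs_pos.mpr hU) (Int.natAbs_dvd_natAbs.mpr hdvd)
      have h' : ((Rat.divInt U V).num.natAbs : ℝ) ≤ (U.natAbs : ℝ) := by exact_mod_cast h
      simpa [Nat.cast_natAbs] using h'
  · have hdvd : ((Rat.divInt U V).den : ℤ) ∣ V := Rat.den_dvd U V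
    have h := Nat.le_of_dvd (Int.natAbs_pos.mpr hV) (Int.natAbs_dvd_natAbs.mpr hdvd)
    have h' : (((Rat.divInt U V).den : ℤ).natAbs : ℝ) ≤ (V.natAbs : ℝ) := by exact_mod_cast h
    simpa [Nat.cast_natAbs] using h'

/-- **LEMMA H** (the arithmetic half, pointwise): two monic relations — one for `t`, one for `t·y^b` — with lower
coefficients of degree `≤ a·i` force `b·h(y) ≤ a·h(x) + C`, `C` depending on the relations only.
(`u₁ = D₁den(x)^a t`, `u₂ = D₂den(x)^a t y^b` are integers of size `≪ H(x)^a`, and `y^b = u₂D₁/(u₁D₂)`.) -/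
theorem logHt_le_of_rels {a b m₁ m₂ : ℕ} (hm₁ : 1 ≤ m₁) (hm₂ : 1 ≤ m₂) {D₁ D₂ : ℤ} (hD₁ : D₁ ≠ 0)
    (hD₂ : D₂ ≠ 0) {χ₁ χ₂ : ℕ → ℤ[X]} (hχ₁ : ∀ i, (χ₁ i).natDegree ≤ a * i)
    (hχ₂ : ∀ i, (χ₂ i).natDegree ≤ a * i) :
    ∃ C : ℝ, 0 ≤ C ∧ ∀ x y t : ℚ, t ≠ 0 →
      (D₁ : ℚ) * t ^ m₁ + ∑ i ∈ Finset.Icc 1 m₁, (aeval x (χ₁ i) : ℚ) * t ^ (m₁ - i) = 0 →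
      (D₂ : ℚ) * (t * y ^ b) ^ m₂ +
          ∑ i ∈ Finset.Icc 1 m₂, (aeval x (χ₂ i) : ℚ) * (t * y ^ b) ^ (m₂ - i) = 0 →
      (b : ℝ) * logHt y ≤ (a : ℝ) * logHt x + C := by
  set K₁ := relConst m₁ D₁ χ₁ with hK₁
  set K₂ := relConst m₂ D₂ χ₂ with hK₂
  set M : ℝ := K₂ * |(D₁ : ℝ)| + K₁ * |(D₂ : ℝ)| with hM
  have hD₁' : (1 : ℝ) ≤ |(D₁ : ℝ)| := by exact_mod_cast Int.one_le_abs hD₁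
  have hD₂' : (1 : ℝ) ≤ |(D₂ : ℝ)| := by exact_mod_cast Int.one_le_abs hD₂
  have hM1 : 1 ≤ M := by
    have := two_le_relConst m₁ D₁ χ₁; have := two_le_relConst m₂ D₂ χ₂; rw [hM]; nlinarith
  refine ⟨Real.log M, Real.log_nonneg hM1, fun x y t ht h₁ h₂ => ?_⟩
  obtain ⟨u₁, hu₁⟩ := exists_int_eq_of_rel hm₁ hχ₁ h₁
  obtain ⟨u₂, hu₂⟩ := exists_int_eq_of_rel hm₂ hχ₂ h₂
  have hb₁ := abs_le_of_rel hm₁ hχ₁ h₁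
  have hb₂ := abs_le_of_rel hm₂ hχ₂ h₂
  rw [← hu₁, Rat.cast_intCast] at hb₁
  rw [← hu₂, Rat.cast_intCast] at hb₂
  have hs : (x.den : ℚ) ≠ 0 := by exact_mod_cast x.den_ne_zero
  have hu₁0 : u₁ ≠ 0 := by
    rintro rfl
    simp only [Int.cast_zero] at hu₁
    exact (mul_ne_zero (mul_ne_zero (Int.cast_ne_zero.mpr hD₁) (pow_ne_zero _ hs)) ht) hu₁.symm
  have hV : u₁ * D₂ ≠ 0 := mul_ne_zero hu₁0 hD₂
  have hyb : y ^ b = ((u₂ * D₁ : ℤ) : ℚ) / ((u₁ * D₂ : ℤ) : ℚ) := by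
    push_cast
    rw [hu₁, hu₂]
    field_simp
  have hHa : 0 < HtQ x ^ a := pow_pos (HtQ_pos x) a
  have hmax : max |((u₂ * D₁ : ℤ) : ℝ)| |((u₁ * D₂ : ℤ) : ℝ)| ≤ M * HtQ x ^ a := by
    push_cast
    rw [abs_mul, abs_mul]
    have e₁ : |(u₂ : ℝ)| * |(D₁ : ℝ)| ≤ K₂ * HtQ x ^ a * |(D₁ : ℝ)| :=
      mul_le_mul_of_nonneg_right hb₂ (abs_nonneg _)
    have e₂ : |(u₁ : ℝ)| * |(D₂ : ℝ)| ≤ K₁ * HtQ x ^ a * |(D₂ : ℝ)| :=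
      mul_le_mul_of_nonneg_right hb₁ (abs_nonneg _)
    have p₁ : 0 ≤ |(u₂ : ℝ)| * |(D₁ : ℝ)| := by positivity
    have p₂ : 0 ≤ |(u₁ : ℝ)| * |(D₂ : ℝ)| := by positivity
    refine max_le ?_ ?_ <;> rw [hM] <;> nlinarith
  have hVpos : 0 < max |((u₂ * D₁ : ℤ) : ℝ)| |((u₁ * D₂ : ℤ) : ℝ)| :=
    lt_max_of_lt_right (abs_pos.mpr (by exact_mod_cast hV))
  calc (b : ℝ) * logHt y = Real.log (HtQ (y ^ b)) := by rw [HtQ_pow, Real.log_pow, logHt_eq_log_HtQ]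
    _ ≤ Real.log (max |((u₂ * D₁ : ℤ) : ℝ)| |((u₁ * D₂ : ℤ) : ℝ)|) := by
        rw [hyb]; exact Real.log_le_log (HtQ_pos _) (HtQ_intDiv_le _ _ hV)
    _ ≤ Real.log (M * HtQ x ^ a) := Real.log_le_log hVpos hmax
    _ = (a : ℝ) * logHt x + Real.log M := by
        rw [Real.log_mul (by positivity) hHa.ne', Real.log_pow, logHt_eq_log_HtQ]; ring

/-! ### §4  On the curve: the relations at a rational point, the finite exceptional set, the ONE-SIDED comparison -/

/-- a relation divisible by `P` over `ℚ` holds at every rational point of `P = 0` with `H ≠ 0`, for `t = G/H`. -/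
theorem rel_at_point {P G H : ℤ[X][X]} {m : ℕ} {D : ℤ} {χ : ℕ → ℤ[X]}
    (hdvd : QDvd P (relPoly m D χ G H)) {x y : ℚ} (hP : (ratModel P).evalEval x y = 0)
    (hH : (ratModel H).evalEval x y ≠ 0) :
    (D : ℚ) * ((ratModel G).evalEval x y / (ratModel H).evalEval x y) ^ m +
      ∑ i ∈ Finset.Icc 1 m, (aeval x (χ i) : ℚ) *
        ((ratModel G).evalEval x y / (ratModel H).evalEval x y) ^ (m - i) = 0 := by
  obtain ⟨R, hR⟩ := hdvd
  have h0 : (ratModel (relPoly m D χ G H)).evalEval x y = 0 := by rw [hR, evalEval_mul, hP, zero_mul]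
  rw [evalEval_ratModel_relPoly] at h0
  set g := (ratModel G).evalEval x y
  set h := (ratModel H).evalEval x y
  have key : (D : ℚ) * (g / h) ^ m + ∑ i ∈ Finset.Icc 1 m, (aeval x (χ i) : ℚ) * (g / h) ^ (m - i) =
      ((D : ℚ) * g ^ m + ∑ i ∈ Finset.Icc 1 m, (aeval x (χ i) : ℚ) * g ^ (m - i) * h ^ i) / h ^ m := by
    rw [add_div, Finset.sum_div]
    congr 1
    · rw [div_pow, mul_div_assoc]
    · refine Finset.sum_congr rfl fun i hi => ?_
      have him := (Finset.mem_Icc.mp hi).2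
      have hsplit : h ^ m = h ^ (m - i) * h ^ i := by rw [← pow_add, Nat.sub_add_cancel him]
      rw [hsplit, div_pow, mul_assoc, mul_div_assoc, mul_div_mul_right _ _ (pow_ne_zero i hH)]
  rw [key, h0, zero_div]

/-- a relation divisible by an IRREDUCIBLE `P` over `ℚ` has positive formal degree (`P` divides no nonzero constant). -/
theorem one_le_of_qdvd_relPoly {P G H : ℤ[X][X]} (hirr : Irreducible (ratModel P)) {m : ℕ} {D : ℤ}
    {χ : ℕ → ℤ[X]} (hD : D ≠ 0) (hdvd : QDvd P (relPoly m D χ G H)) : 1 ≤ m := by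
  by_contra hm
  have hm0 : m = 0 := by omega
  subst hm0
  have hrel : relPoly 0 D χ G H = C (C D) := by simp [relPoly]
  rw [QDvd, hrel, ratModel_C, map_C, eq_intCast] at hdvd
  have hu : IsUnit (C (C (D : ℚ)) : ℚ[X][X]) :=
    isUnit_C.mpr (isUnit_C.mpr (isUnit_iff_ne_zero.mpr (by exact_mod_cast hD)))
  exact hirr.not_isUnit (isUnit_of_dvd_unit hdvd hu)

/-- `¬ P ∣ G`, `¬ P ∣ H` over `ℚ` and `P` irreducible over `ℚ` ⇒ `¬ P ∣ G·H` (`ℚ[x][Y]` is factorial). -/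
theorem not_qdvd_mul {P G H : ℤ[X][X]} (hirr : Irreducible (ratModel P)) (hG : ¬ QDvd P G)
    (hH : ¬ QDvd P H) : ¬ ratModel P ∣ ratModel (G * H) := by
  rw [ratModel_mul]
  exact fun h => (hirr.prime.dvd_or_dvd h).elim hG hH

/-- choice of the order `b`: `c₀ ≤ ε·b` with `b ≥ 1`. -/
theorem exists_nat_ge_div (c₀ : ℕ) {ε : ℝ} (hε : 0 < ε) : ∃ b : ℕ, 1 ≤ b ∧ (c₀ : ℝ) ≤ ε * b := by
  refine ⟨⌈(c₀ : ℝ) / ε⌉₊ + 1, by omega, ?_⟩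
  have h1 : (c₀ : ℝ) / ε ≤ ⌈(c₀ : ℝ) / ε⌉₊ := Nat.le_ceil _
  have h2 : (c₀ : ℝ) = (c₀ : ℝ) / ε * ε := (div_mul_cancel₀ _ hε.ne').symm
  push_cast
  nlinarith

/-- **THE ONE-SIDED HEIGHT COMPARISON FROM SIEGEL FUNCTIONS** (the arithmetic half, proved): if `P` is irreducible
over `ℚ` and carries Siegel functions, then for every `ε > 0` there is `c` with
`deg_Y P · h(y) ≤ (xdeg P + ε)·h(x) + c` at every rational point of `P = 0`.
Proof: pick `b` with `c₀/b ≤ ε`, Siegel functions `φ = G/H`, `φ·Y^b` integral of degree `≤ a`, `a·n ≤ b·k + c₀`;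
LEMMA H at the points with `G·H ≠ 0`; the points with `G·H = 0` are finitely many (weak Bézout, Literature
`commonZeros_finite_ncard_le`). -/
theorem upperComparisonAt_of_siegelFunctions {P : ℤ[X][X]} (hirr : Irreducible (ratModel P))
    (hS : SiegelFunctions P) : UpperComparisonAt P := by
  classical
  intro ε hε
  obtain ⟨c₀, hc₀⟩ := hS
  obtain ⟨b, hb1, hbε⟩ := exists_nat_ge_div c₀ hε
  obtain ⟨a, G, H, hab, hG, hH, ⟨m₁, D₁, χ₁, hD₁, hχ₁, hdvd₁⟩, ⟨m₂, D₂, χ₂, hD₂, hχ₂, hdvd₂⟩⟩ := hc₀ b hb1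
  have hm₁ := one_le_of_qdvd_relPoly hirr hD₁ hdvd₁
  have hm₂ := one_le_of_qdvd_relPoly hirr hD₂ hdvd₂
  obtain ⟨C, hC0, hC⟩ := logHt_le_of_rels (b := b) hm₁ hm₂ hD₁ hD₂ hχ₁ hχ₂
  obtain ⟨hfin, -⟩ := Literature.NumberTheory.DiophantineGeometry.Dioph.commonZeros_finite_ncard_le hirr
    (not_qdvd_mul hirr hG hH) (natDegree_ratModel_le P) (natDegree_coeff_ratModel_le P)
    (natDegree_ratModel_le (G * H)) (natDegree_coeff_ratModel_le (G * H))
  set E := hfin.toFinset with hE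
  set cE : ℝ := ∑ q ∈ E, (P.natDegree : ℝ) * logHt q.2 with hcE
  have hn0 : (0 : ℝ) ≤ P.natDegree := Nat.cast_nonneg _
  have hcE0 : 0 ≤ cE := Finset.sum_nonneg fun q _ => mul_nonneg hn0 (logHt_nonneg _)
  refine ⟨C * P.natDegree + cE, fun x y hxy => ?_⟩
  have hP : (ratModel P).evalEval x y = 0 := (bev_eq_zero_iff_ratModel P x y).mp hxy
  have hx0 : 0 ≤ logHt x := logHt_nonneg x
  have hk0 : (0 : ℝ) ≤ (xdeg P : ℝ) + ε := by positivity
  have hkx : 0 ≤ ((xdeg P : ℝ) + ε) * logHt x := mul_nonneg hk0 hx0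
  have hCn : 0 ≤ C * P.natDegree := mul_nonneg hC0 hn0
  by_cases hGH : (ratModel (G * H)).evalEval x y = 0
  · have hmem : (x, y) ∈ E := by
      rw [hE, Set.Finite.mem_toFinset]
      exact ⟨hP, hGH⟩
    have h1 : (P.natDegree : ℝ) * logHt y ≤ cE :=
      Finset.single_le_sum (f := fun q : ℚ × ℚ => (P.natDegree : ℝ) * logHt q.2)
        (fun q _ => mul_nonneg hn0 (logHt_nonneg _)) hmem
    linarith
  · rw [ratModel_mul, evalEval_mul] at hGH
    have hG0 : (ratModel G).evalEval x y ≠ 0 := fun h => hGH (by rw [h, zero_mul])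
    have hH0 : (ratModel H).evalEval x y ≠ 0 := fun h => hGH (by rw [h, mul_zero])
    have ht : (ratModel G).evalEval x y / (ratModel H).evalEval x y ≠ 0 := div_ne_zero hG0 hH0
    have h₁ := rel_at_point hdvd₁ hP hH0
    have h₂ := rel_at_point hdvd₂ hP hH0
    have ht2 : (ratModel (G * X ^ b)).evalEval x y / (ratModel H).evalEval x y =
        (ratModel G).evalEval x y / (ratModel H).evalEval x y * y ^ b := by
      rw [ratModel_mul, ratModel_pow, ratModel_X, evalEval_mul, evalEval_pow, evalEval_X]
      ring
    rw [ht2] at h₂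
    have hmain := hC x y _ ht h₁ h₂
    have hab' : (a : ℝ) * P.natDegree ≤ (b : ℝ) * ((xdeg P : ℝ) + ε) := by
      have h := (Nat.cast_le (α := ℝ)).mpr hab
      push_cast at h
      nlinarith
    have hb0 : (0 : ℝ) < b := by exact_mod_cast hb1
    have hb1' : (1 : ℝ) ≤ b := by exact_mod_cast hb1
    have e1 : (b : ℝ) * ((P.natDegree : ℝ) * logHt y) ≤
        (b : ℝ) * ((((xdeg P : ℝ) + ε)) * logHt x + C * P.natDegree) := by
      calc (b : ℝ) * ((P.natDegree : ℝ) * logHt y) = (P.natDegree : ℝ) * ((b : ℝ) * logHt y) := by ring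
        _ ≤ (P.natDegree : ℝ) * ((a : ℝ) * logHt x + C) := mul_le_mul_of_nonneg_left hmain hn0
        _ = (a : ℝ) * P.natDegree * logHt x + C * P.natDegree := by ring
        _ ≤ (b : ℝ) * ((xdeg P : ℝ) + ε) * logHt x + (b : ℝ) * (C * P.natDegree) :=
            add_le_add (mul_le_mul_of_nonneg_right hab' hx0) (le_mul_of_one_le_left hCn hb1')
        _ = (b : ℝ) * ((((xdeg P : ℝ) + ε)) * logHt x + C * P.natDegree) := by ring
    have e2 := le_of_mul_le_mul_left e1 hb0
    linarith

end Summit.Schanuel.Schanuel.Theorems.RootDecomp1KSiegelFunctions
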